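import Literature.NumberTheory.DiophantineGeometry.BcgpSwitchExistsModularAbelianSurface
import Literature.NumberTheory.GaloisRepresentations.OrdinaryPDistinguished
import HarnessLib

/-!
# Boxer–Calegari–Gee–Pilloni 2025, Definition 9.1.2 (remark) with §1.8.23: an abelian surface with
# good ordinary reduction at `p` whose Frobenius polynomial at `p` has distinct roots is ordinary and
# `p`-distinguished at `p`

Topic `Literature/NumberTheory/DiophantineGeometry` (next to `BcgpResiduallyA5bModular`,
`Bcgp2025ModThreeSurjectiveModular`, `AbelianVarietyOrdinaryReduction`). ONE named fact (D-0014), no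
proof, no new definition: the printed criterion by which G. Boxer, F. Calegari, T. Gee, V. Pilloni,
*Modularity theorems for abelian surfaces*, arXiv:2502.20645 (2025), pass from the arithmetic
hypothesis "good ordinary reduction at `p` and the characteristic polynomial of Frobenius at `p` has
no repeated roots" (Theorem A (3), Theorem 9.5.2 (3), Lemma 9.4.2) to the Galois-theoretic hypothesis
"`ρ_{A,p}|_{G_{ℚ_p}}` is ordinary and `p`-distinguished" (Definition 1.8.10; Theorem 8.3.2 (3); the
modularity lifting Theorem 9.5.1).  Vendored by the literature seat of the venture cell `pub-residmod`
as the cell's "bridge B2" (`run/shared/lean/pub/pub-residmod/lean-p2/BRIDGES.md`): it turns the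
certified local data at `2` of a genus-2 Jacobian (good ordinary reduction at `2`, `L₂(T)` separable)
into hypothesis (3) of the tree fact
`Literature.NumberTheory.DiophantineGeometry.bcgp_residuallyA5b_modular_abelianSurface`
(Theorem 8.3.2), whose clause is `r₂.IsOrdinaryPDistinguishedAt v`.

## The printed statements (arXiv v1 numbering: all numbered items share the subsubsection counter;
## TeX chunk ids of the held rendering `paper:arxiv-2502.20645` are locators, not PDF pages)

* §1.8.23 (Galois representations of abelian surfaces; chunk p0011 L70–79): "The representation
  `ρ_{A,p}` is unramified at all but finitely many places `v` of `F`, and if `v | p` then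
  `ρ_{A,p}|_{G_{F_v}}` is de Rham with Hodge–Tate weights `0,0,1,1` … If `A/F_v` has good ordinary
  reduction for some `v | p`, then `ρ_{A,p}|_{G_{F_v}}` is crystalline and ordinary of weight 2."
  (Conventions, same §: `ρ_{A,p}` is the representation on `H¹(A_F̄, ℤ_p)`, multiplier `ε⁻¹`; the
  representations on `T_p(A)` and `A[p]` are the duals `ρ^∨_{A,p} ≃ ρ_{A,p} ⊗ ε`.)
* §1.8.9, Definition 1.8.10 (tree: `FramedGaloisRep.IsOrdinaryPDistinguished`, file
  `GaloisRepresentations/OrdinaryPDistinguished.lean`, quoted there in full): `ρ : G_K → GSp₄(ℚ̄_p)`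
  with similitude `ε⁻¹` is *ordinary* if `ρ ≅` an upper-triangular representation with diagonal
  `(χ₁, χ₂, ε⁻¹χ₂⁻¹, ε⁻¹χ₁⁻¹)`, and *`p`-distinguished* if these four characters are pairwise
  distinct.
* §9.1, Definition 9.1.2 (label `defn:p-distinguished`; chunk p0125 L74–90), verbatim: "Let `B/ℚ_p`
  be an abelian surface for which the associated Galois representation on `T_pB` is ordinary.  We say
  that `B` is `p`-distinguished if the corresponding representation `ρ_{B,p} : G_{ℚ_p} → GSp₄(ℚ_p)` is
  `p`-distinguished in the sense of Definition 1.8.10.  For example, if `B` has good ordinary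
  reduction, then `B` is `p`-distinguished if and only if the characteristic polynomial `Q(x)` of
  `Frob_p` on `T_ℓ B`, `ℓ ≠ p`, has pairwise distinct roots, or equivalently if `Q(x)` is not a
  square.  If `B₀/𝔽_p` is ordinary, we say that `B₀` is `p`-distinguished if the characteristic
  polynomial `Q(x)` of Frobenius has pairwise distinct roots.  If `X/ℚ_p` is a genus `2` curve, we
  say that `X` is `p`-distinguished if `Jac(X)` is `p`-distinguished."  (Remark 9.1.1 just before it:
  "`T_pB` and `B[p]` correspond to `ρ^∨_{B,p}` and `ρ̄^∨_{B,p}` … since these representations are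
  self-dual up to twist, the associated projective representations are independent of this choice.")

The source prints these two sentences without proof; they are the standard consequences of the
connected–étale sequence of the `p`-divisible group of the abelian-scheme model (Serre–Tate, Tate;
Greenberg's "ordinary" filtration — tree named fact `ordinaryReduction_tateModule_filtration` in
`AbelianVarietyOrdinaryReduction.lean`, which records the INERTIA-level statement on `V_p(B)`) together
with: the unramified quotient carries the unit-root eigenvalues of Frobenius, which are two of the four
roots of `Q(x)` (so the unramified characters `χ₁, χ₂` of Definition 1.8.10 differ iff the two unit
roots differ iff `Q` has no repeated root), and `χ_i ≠ ε⁻¹χ_j⁻¹` always (`ε` is infinitely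
ramified).  A discharge needs the Frobenius action on the étale quotient of `𝒜[p^∞]` and its
comparison with the `ℓ`-adic Frobenius polynomial (Weil, Tate), absent from Mathlib and the tree:
SIZE L.

## Rendering (the reading reviewers should attack)

For `B : AbelianVariety ℚ` with `B.dim = 2` (the source's `B/ℚ_p` is any abelian surface over
`ℚ_p`; the tree's abelian varieties live over number fields and its local notions are phrased at a
finite place, so the fact is recorded for `B_{ℚ_p}` with `B/ℚ` — the special case every consumer
has; TODO(general form): `B` over a `p`-adic field), a prime `p` and the place `v ∣ p` of `ℚ`:
* "good ordinary reduction (at `p`)" ↦ `B.HasGoodOrdinaryReductionAt v`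
  (`AbelianVarietyOrdinaryReduction.lean`: an abelian-scheme model over `𝓞_{(v)}` whose special
  fibre has `p`-rank `2`);
* "the characteristic polynomial `Q(x)` of `Frob_p` on `T_ℓ B`, `ℓ ≠ p`, has pairwise distinct
  roots" ↦ EXACTLY clause (3b) of the accepted sibling `bcgp2025_modThreeSurjective_modular_abelianSurface`
  (there at `p = 3`): for every prime `ℓ ≠ p` and every framed dual `r'` of `V_ℓ(B)`
  (`r'(g) = [g⁻¹]_{b'}ᵀ` in a `ℚ_ℓ`-basis `b'`, read in `ℚ̄_ℓ`), `r'` is unramified at `v` and every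
  Frobenius characteristic polynomial `Q` of `r'` at `v` (`FramedGaloisRep.HasFrobCharpolyAt`) is
  separable — over the algebraically closed field `ℚ̄_ℓ` "separable" is "pairwise distinct roots";
  passing from `T_ℓ B` to its dual replaces `Q` by its scaled reciprocal, which has distinct roots iff
  `Q` does (Remark 9.1.1).  This is the shape the cell's kernel bridge produces from an Euler factor
  (`HasGoodEulerFactorAt p L ∧ L separable`);
* CONCLUSION "the Galois representation is ordinary (§1.8.23) and `B` is `p`-distinguished
  (Definition 9.1.2), i.e. `ρ_{B,p}|_{G_{ℚ_p}}` is ordinary and `p`-distinguished in the sense of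
  Definition 1.8.10" ↦ for every framed dual `r` of `V_p(B)` (`r(g) = [g⁻¹]_bᵀ` in a `ℚ_p`-basis `b`,
  read in `ℚ̄_p`: the paper's `ρ_{B,p}` on `H¹`, cohomological convention, the convention of the
  tree predicate), `r.IsOrdinaryPDistinguishedAt v` — VERBATIM the clause of hypothesis (3) of
  `bcgp_residuallyA5b_modular_abelianSurface`.  (All framed duals are `GL₄(ℚ̄_p)`-conjugate and the
  predicate is frame-invariant, `isOrdinaryPDistinguishedAt_conj_iff`.)
Only the direction "`Q` without repeated roots ⇒ `p`-distinguished" of the printed "if and only if"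
is recorded (the direction used downstream; the converse would need the unramifiedness side
condition stated separately).  TODO(converse).

## Printed conditionality

None for these two sentences (they are unconditional statements about abelian surfaces over `ℚ_p`,
printed without proof as standard).  The named fact is consumed, as every named fact, as an explicit
hypothesis `(h : bcgp2025_goodOrdinary_pDistinguished_abelianSurface)`.

## References

* [BoxerCalegariGeePilloni2025] G. Boxer, F. Calegari, T. Gee, V. Pilloni, *Modularity theorems
  for abelian surfaces*, arXiv:2502.20645 (2025): §1.8.9 Definition 1.8.10; §1.8.23 ("good ordinary
  reduction ⇒ crystalline and ordinary of weight 2"); §9.1 Remark 9.1.1, Definition 9.1.2 (the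
  `p`-distinguished criterion); Theorem 8.3.2 (3), Theorem A (3), Theorem 9.5.2 (3) (where it is used).
* [Greenberg1991] R. Greenberg, *Iwasawa theory for motives*, §2 (ordinary `p`-adic representations;
  the Tate module of an abelian variety with good ordinary reduction) — background for "ordinary",
  recorded in the tree as `ordinaryReduction_tateModule_filtration`.
-/

namespace Literature.NumberTheory.DiophantineGeometry

open IsDedekindDomain
open scoped NumberField Matrix
open Literature.NumberTheory.GaloisRepresentations
open Literature.AlgebraicGeometry.Motives (AbelianVariety)

/-- **Boxer–Calegari–Gee–Pilloni 2025, Definition 9.1.2 (the "for example" criterion) with §1.8.23.**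
"If `A/F_v` has good ordinary reduction for some `v | p`, then `ρ_{A,p}|_{G_{F_v}}` is crystalline and
ordinary of weight 2" (§1.8.23) and "if `B` [an abelian surface over `ℚ_p`] has good ordinary
reduction, then `B` is `p`-distinguished [i.e. `ρ_{B,p} : G_{ℚ_p} → GSp₄(ℚ_p)` is `p`-distinguished in
the sense of Definition 1.8.10] if and only if the characteristic polynomial `Q(x)` of `Frob_p` on
`T_ℓ B`, `ℓ ≠ p`, has pairwise distinct roots, or equivalently if `Q(x)` is not a square"
(Definition 9.1.2) — recorded for `B/ℚ` at the place `v ∣ p`, direction "⇐": if `B` is an abelian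
surface over `ℚ` with good ordinary reduction at `v ∣ p` such that, for every `ℓ ≠ p`, every framed
dual of `V_ℓ(B)` is unramified at `v` with separable Frobenius characteristic polynomials there, then
every framed dual `r` of `V_p(B)` (the paper's `ρ_{B,p}` on `H¹`) is ordinary and `p`-distinguished at
`v` (`FramedGaloisRep.IsOrdinaryPDistinguishedAt`, Definition 1.8.10).
[cite: BoxerCalegariGeePilloni2025, §9.1 Definition 9.1.2 (p-distinguished iff Q(x) has pairwise distinct roots, for good ordinary reduction) and §1.8.23 (good ordinary reduction implies ordinary); §1.8.9 Definition 1.8.10] -/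
def bcgp2025_goodOrdinary_pDistinguished_abelianSurface : Prop :=
  ∀ (B : AbelianVariety ℚ), B.dim = 2 →
    ∀ (p : ℕ) [Fact p.Prime] (v : HeightOneSpectrum (𝓞 ℚ)), ((p : ℕ) : 𝓞 ℚ) ∈ v.asIdeal →
      -- good ordinary reduction at `p`
      B.HasGoodOrdinaryReductionAt v →
      -- the characteristic polynomial of `Frob_p` on `T_ℓ B`, `ℓ ≠ p`, has pairwise distinct roots
      (∀ (ℓ : ℕ) [Fact ℓ.Prime], ℓ ≠ p →
        ∀ (b' : Module.Basis (Fin 4) ℚ_[ℓ] (B.rationalTateModule ℓ))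
          (r' : FramedGaloisRep ℚ (PadicAlgCl ℓ) 4),
          (∀ g : Field.absoluteGaloisGroup ℚ,
            (r' g).val =
              ((LinearMap.toMatrix b' b' (B.rationalTateRep ℓ g⁻¹)).map
                (algebraMap ℚ_[ℓ] (PadicAlgCl ℓ))).transpose) →
          r'.IsUnramifiedAt v ∧
            ∀ Q : Polynomial (PadicAlgCl ℓ), r'.HasFrobCharpolyAt v Q → Q.Separable) →
      -- conclusion: `ρ_{B,p}|_{G_{ℚ_p}}` is ordinary and `p`-distinguished (Def. 1.8.10)
      ∀ (b : Module.Basis (Fin 4) ℚ_[p] (B.rationalTateModule p))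
        (r : FramedGaloisRep ℚ (PadicAlgCl p) 4),
        (∀ g : Field.absoluteGaloisGroup ℚ,
          (r g).val =
            ((LinearMap.toMatrix b b (B.rationalTateRep p g⁻¹)).map
              (algebraMap ℚ_[p] (PadicAlgCl p))).transpose) →
        r.IsOrdinaryPDistinguishedAt v

end Literature.NumberTheory.DiophantineGeometry
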